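import Literature.MathematicalPhysics.QuantumFieldTheory.Balaban1983to89.T3UnitScaleTilt
import Literature.MathematicalPhysics.QuantumFieldTheory.Balaban1983to89.TorusHypercubicSymmetry
import Literature.MathematicalPhysics.QuantumFieldTheory.Balaban1983to89.T4Covariance
import Literature.MathematicalPhysics.QuantumFieldTheory.Balaban1983to89.B12RegularClassInvariance263
import HarnessLib

/-!
# The Gibbs law of the height-`j` block-averaged field is invariant under coordinate permutations and block-lattice
# translations; hence the law of `dist1(Ū^j(∂a))` does not depend on the plaquette `a` («one plaquette per height»)

Cell `ym3-torus` (HUMAN RULING D-0037, YM ladder rung R3 = continuum SU(2) Yang–Mills on the three-torus — NOT d = 4, NOT infinite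
volume, NOT a mass gap, NOT the Clay problem), width seat `ym-ust-19936-w3` gen 18; helper for LINE 28 «gross_transfer» on
stmt-QuantumFields-23083 (pen of record ★w2-19936 g15, accounting v2 (B)(iii) / v3-draft design choice (α): «an axis-permutation
equivariance lemma for the (0.4) tower … would make (iii) the only case — a pen for someone»).

WHAT IS PROVED (lattice-symmetry bookkeeping over landed Literature lemmas; def-free; nothing of any crux):
* §1 (generic `P : Params`, `β ≥ 0`, any gauge group with Haar data) `T4GenFunBounds.gibbsMeasure P β` is invariant AS A MEASURE
  under `GaugeField.permute π` and `GaugeField.translate a` (`gibbsMeasure_map_permute/translate`, read on indicators from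
  ✓`T4GenFunBounds.integral_gibbsMeasure_eq_expect` + ✓`Missing.expect_permute` / ✓`Missing.expect_translate`), with every-set and
  every-integrand forms (both maps are measurable equivalences — no measurability hypotheses anywhere);
* §2 (with lit ✓`B12RegularClassInvariance263.dist1_plaqHol_permute : dist1 ((π·U)(∂p)) = dist1 (U(∂(π·p)))`, `Plaq.permute`
  re-ordering the directions — an orientation reversal inverts the holonomy, `dist1 g⁻¹ = dist1 g`) the covariance of
  Bałaban's (0.4) tower `Averaging.iter (fun i => BlockAveraging.blockAvg ℰ) j` under permutations (✓`T4Continuum.iter_permute` ∘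
  ✓`BlockAveraging.blockAvg_permute`) and under translations of level `j` by `b`, realised on the finest field by `Site.scaleTo j b`
  (✓`T4Continuum.iter_translate` ∘ ✓`BlockAveraging.blockAvg_translate`); and `exists_permute_translate_eq`: any two plaquettes of
  one level are related by a coordinate permutation followed by a translation;
* §3–§4 hence the LAW OF `Ū^j = avg^j U` under the Gibbs measure is invariant under `permute π` / `translate b`, and for EVERY
  `φ : ℝ → ℝ`, every predicate `Q : ℝ → Prop` and any two plaquettes `p q : Plaq P j`:
  `∫ φ(dist1(Ū^j(∂p))) dGibbs = ∫ φ(dist1(Ū^j(∂q))) dGibbs`, `Gibbs{Q(dist1(Ū^j(∂p)))} = Gibbs{Q(dist1(Ū^j(∂q)))}`;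
* §5 the same in the `T3UnitScaleTilt` tokens (`gibbsK F ℰ γ K`, `Plaq (F.P K) j`, `0 ≤ γ`) and four consumer-shaped REDUCTIONS
  «ONE reference plaquette ⇒ every plaquette of that height»: first moment (stmt-23083/23133/23134), second moment (LINE 28
  `shallowFluxSecondMomentL`), quantile ((Q) `stub_quantileDeviation`), large-field tail (K2 per-plaquette; LINE 31 S1's wording).

WHY (LINE 28): for block plaquettes `a` with `0 ∉ {a.μ, a.ν}` the axial-comb column charge vanishes identically (accounting v2
(B)(iii)), while `(0,μ)`-oriented `a` need the column-charge cure (B)(ii); the comb of `stub_linTest`'s text has a FIXED axis order, so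
the reduction is made here one level up, on the comb-free targets, which do not depend on `a` at all.  HONEST: proves no stub;
`stub_linTest`, (Q), stmt-23083/23133/23134, K1 stmt-23532, MD, stmt-24187 and the crux `HistoryTailL` (stmt-QuantumFields-19936) are
NOT proved; YM₃ on T³ is rung R3 — NOT d = 4, NOT infinite volume, NOT a mass gap, NOT the Clay problem; the YM mass gap is NOT proved.
-/

noncomputable section

open MeasureTheory
open Literature.MathematicalPhysics.QuantumFieldTheory.Balaban1983to89
open Literature.MathematicalPhysics.QuantumFieldTheory.Balaban1983to89.T3ContinuumYM3Torus
open Literature.MathematicalPhysics.QuantumFieldTheory.Balaban1983to89.T3UnitScaleTilt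

namespace Summit.QuantumFields.YangMills.Theorems.UnitScaleGibbsAveragedPlaquetteLawSymmetry

/-! ## §1 The Wilson–Gibbs measure is invariant under coordinate permutations and lattice translations (as a measure) -/

section Gibbs

variable {P : Params} {G : Type*} [GaugeGroup G] [MeasurableSpace G] [HaarData G] [RegularGaugeGroup G]

omit [GaugeGroup G] [HaarData G] [RegularGaugeGroup G] in
/-- `U ↦ π·U` is a measurable embedding (the relabelling `(MeasurableEquiv.piCongrLeft _ (PBond.permuteEquiv π)).symm`). [folklore] -/
theorem measurableEmbedding_permute {j : ℕ} (π : Equiv.Perm (Fin P.d)) :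
    MeasurableEmbedding (GaugeField.permute (G := G) (P := P) (j := j) π) := by
  have hme := (MeasurableEquiv.piCongrLeft (fun _ : PBond P j => G) (PBond.permuteEquiv π)).symm.measurableEmbedding
  have hcoe : ⇑(MeasurableEquiv.piCongrLeft (fun _ : PBond P j => G) (PBond.permuteEquiv π)).symm =
      GaugeField.permute (G := G) (P := P) (j := j) π :=
    funext (GaugeField.piCongrLeft_permuteEquiv_symm_apply π)
  rw [hcoe] at hme
  exact hme

omit [GaugeGroup G] [HaarData G] [RegularGaugeGroup G] in
/-- `U ↦ τ_a U` is a measurable embedding (the relabelling `(MeasurableEquiv.piCongrLeft _ (PBond.translateEquiv a)).symm`). [folklore] -/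
theorem measurableEmbedding_translate {j : ℕ} (a : Site P j) :
    MeasurableEmbedding (GaugeField.translate (G := G) (P := P) (j := j) a) := by
  have hme := (MeasurableEquiv.piCongrLeft (fun _ : PBond P j => G) (PBond.translateEquiv a)).symm.measurableEmbedding
  have hcoe : ⇑(MeasurableEquiv.piCongrLeft (fun _ : PBond P j => G) (PBond.translateEquiv a)).symm =
      GaugeField.translate (G := G) (P := P) (j := j) a :=
    funext (GaugeField.piCongrLeft_symm_apply a)
  rw [hcoe] at hme
  exact hme

/-- **Change of variables `U ↦ π·U` under the Gibbs measure**, EVERY integrand (junk = junk): `∫ F(π·U) dGibbs = ∫ F dGibbs`. [folklore] -/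
theorem integral_gibbsMeasure_comp_permute {β : ℝ} (hβ : 0 ≤ β) (π : Equiv.Perm (Fin P.d)) (F : GaugeField P 0 G → ℝ) :
    ∫ U, F (U.permute π) ∂T4GenFunBounds.gibbsMeasure P β = ∫ U, F U ∂T4GenFunBounds.gibbsMeasure (G := G) P β := by
  rw [T4GenFunBounds.integral_gibbsMeasure_eq_expect P hβ (fun U => F (U.permute π)),
    T4GenFunBounds.integral_gibbsMeasure_eq_expect P hβ F, Missing.expect_permute]

/-- **Change of variables `U ↦ τ_a U` under the Gibbs measure**, EVERY integrand: `∫ F(τ_a U) dGibbs = ∫ F dGibbs`. [folklore] -/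
theorem integral_gibbsMeasure_comp_translate {β : ℝ} (hβ : 0 ≤ β) (a : Site P 0) (F : GaugeField P 0 G → ℝ) :
    ∫ U, F (U.translate a) ∂T4GenFunBounds.gibbsMeasure P β = ∫ U, F U ∂T4GenFunBounds.gibbsMeasure (G := G) P β := by
  rw [T4GenFunBounds.integral_gibbsMeasure_eq_expect P hβ (fun U => F (U.translate a)),
    T4GenFunBounds.integral_gibbsMeasure_eq_expect P hβ F, Missing.expect_translate]

/-- From an every-integrand change of variables under a measurable map to the push-forward identity (read on indicators). [folklore] -/
theorem map_eq_of_integral_comp {β : ℝ} (hβ : 0 ≤ β) {f : GaugeField P 0 G → GaugeField P 0 G} (hf : Measurable f)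
    (h : ∀ F : GaugeField P 0 G → ℝ,
      ∫ U, F (f U) ∂T4GenFunBounds.gibbsMeasure P β = ∫ U, F U ∂T4GenFunBounds.gibbsMeasure (G := G) P β) :
    (T4GenFunBounds.gibbsMeasure (G := G) P β).map f = T4GenFunBounds.gibbsMeasure P β := by
  haveI := T4GenFunBounds.isProbabilityMeasure_gibbsMeasure (G := G) P hβ
  refine Measure.ext fun s hs => ?_
  rw [Measure.map_apply hf hs]
  have key := h (s.indicator 1)
  have hind : (fun U : GaugeField P 0 G => s.indicator (1 : GaugeField P 0 G → ℝ) (f U)) = (f ⁻¹' s).indicator 1 := by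
    funext U
    by_cases hU : f U ∈ s
    · rw [Set.indicator_of_mem hU, Set.indicator_of_mem (Set.mem_preimage.mpr hU)]
      rfl
    · rw [Set.indicator_of_notMem hU, Set.indicator_of_notMem (fun h' => hU (Set.mem_preimage.mp h'))]
  rw [hind, integral_indicator_one (hf hs), integral_indicator_one hs, measureReal_def, measureReal_def] at key
  exact (ENNReal.toReal_eq_toReal_iff' (measure_ne_top _ _) (measure_ne_top _ _)).mp key

/-- **THE GIBBS MEASURE IS PERMUTATION INVARIANT AS A MEASURE**: `(π·)_* Gibbs_{P,β} = Gibbs_{P,β}` (`β ≥ 0`). [folklore] -/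
theorem gibbsMeasure_map_permute {β : ℝ} (hβ : 0 ≤ β) (π : Equiv.Perm (Fin P.d)) :
    (T4GenFunBounds.gibbsMeasure (G := G) P β).map (GaugeField.permute π) = T4GenFunBounds.gibbsMeasure P β :=
  map_eq_of_integral_comp hβ (measurableEmbedding_permute π).measurable (integral_gibbsMeasure_comp_permute hβ π)

/-- **THE GIBBS MEASURE IS TRANSLATION INVARIANT AS A MEASURE**: `(τ_a)_* Gibbs_{P,β} = Gibbs_{P,β}` (`β ≥ 0`). [folklore] -/
theorem gibbsMeasure_map_translate {β : ℝ} (hβ : 0 ≤ β) (a : Site P 0) :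
    (T4GenFunBounds.gibbsMeasure (G := G) P β).map (GaugeField.translate a) = T4GenFunBounds.gibbsMeasure P β :=
  map_eq_of_integral_comp hβ (measurableEmbedding_translate a).measurable (integral_gibbsMeasure_comp_translate hβ a)

/-- Every-set form: `Gibbs((π·)⁻¹ S) = Gibbs(S)` for EVERY set `S` (no measurability: `π·` is a measurable embedding). [folklore] -/
theorem gibbsMeasure_preimage_permute {β : ℝ} (hβ : 0 ≤ β) (π : Equiv.Perm (Fin P.d)) (S : Set (GaugeField P 0 G)) :
    T4GenFunBounds.gibbsMeasure (G := G) P β (GaugeField.permute π ⁻¹' S) = T4GenFunBounds.gibbsMeasure P β S := by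
  rw [← (measurableEmbedding_permute (G := G) π).map_apply (T4GenFunBounds.gibbsMeasure P β) S, gibbsMeasure_map_permute hβ]

/-- Every-set form: `Gibbs(τ_a⁻¹ S) = Gibbs(S)` for EVERY set `S`. [folklore] -/
theorem gibbsMeasure_preimage_translate {β : ℝ} (hβ : 0 ≤ β) (a : Site P 0) (S : Set (GaugeField P 0 G)) :
    T4GenFunBounds.gibbsMeasure (G := G) P β (GaugeField.translate a ⁻¹' S) = T4GenFunBounds.gibbsMeasure P β S := by
  rw [← (measurableEmbedding_translate (G := G) a).map_apply (T4GenFunBounds.gibbsMeasure P β) S, gibbsMeasure_map_translate hβ]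

end Gibbs

/-! ## §2 Plaquette variables and the averaging tower under permutations / translations -/

section Covariance

variable {P : Params} {j : ℕ} {G : Type*} [GaugeGroup G]

/-- **The (0.4) averaging tower commutes with coordinate permutations**: `avg^j(π·U) = π·(avg^j U)`. [cite: Balaban1987RG1, (2.17) p.269] -/
theorem iter_blockAvg_permute (ℰ : LoopAverage G) (π : Equiv.Perm (Fin P.d)) (j : ℕ) (U : GaugeField P 0 G) :
    Averaging.iter (fun i => BlockAveraging.blockAvg (P := P) (j := i) ℰ) j (U.permute π) =
      (Averaging.iter (fun i => BlockAveraging.blockAvg (P := P) (j := i) ℰ) j U).permute π :=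
  T4Continuum.iter_permute (fun i => BlockAveraging.blockAvg (P := P) (j := i) ℰ) π
    (fun _ U => BlockAveraging.blockAvg_permute ℰ π U) j U

/-- **The (0.4) averaging tower commutes with translations across levels**: translating the finest field by `L^j·b` translates
the height-`j` averaged field by `b`. [cite: Balaban1987RG1, (2.17) p.269] -/
theorem iter_blockAvg_translate (ℰ : LoopAverage G) (j : ℕ) (b : Site P j) (U : GaugeField P 0 G) :
    Averaging.iter (fun i => BlockAveraging.blockAvg (P := P) (j := i) ℰ) j (U.translate (Site.scaleTo j b)) =
      (Averaging.iter (fun i => BlockAveraging.blockAvg (P := P) (j := i) ℰ) j U).translate b :=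
  T4Continuum.iter_translate (fun i => BlockAveraging.blockAvg (P := P) (j := i) ℰ)
    (fun _ a U => BlockAveraging.blockAvg_translate ℰ a U) j b U

/-- **Any two plaquettes of one level are related by a coordinate permutation followed by a translation**: `π` with
`π p.μ = q.μ`, `π p.ν = q.ν` (two transpositions), `b := q.src − π·p.src`; then `τ_b (π·p) = q`. [folklore] -/
theorem exists_permute_translate_eq (p q : Plaq P j) :
    ∃ (π : Equiv.Perm (Fin P.d)) (b : Site P j), (p.permute π).translate b = q := by
  set σ₁ : Equiv.Perm (Fin P.d) := Equiv.swap p.μ q.μ with hσ₁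
  set ν' : Fin P.d := σ₁ p.ν with hν'
  set σ₂ : Equiv.Perm (Fin P.d) := Equiv.swap ν' q.ν with hσ₂
  have h1 : σ₁ p.μ = q.μ := by rw [hσ₁, Equiv.swap_apply_left]
  have hν'ne : ν' ≠ q.μ := by
    intro h
    have : σ₁ p.ν = σ₁ p.μ := by rw [← hν', h, h1]
    exact p.hμν.ne' (σ₁.injective this)
  have hπμ : (σ₂ * σ₁) p.μ = q.μ := by
    rw [Equiv.Perm.mul_apply, h1, hσ₂, Equiv.swap_apply_of_ne_of_ne hν'ne.symm q.hμν.ne]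
  have hπν : (σ₂ * σ₁) p.ν = q.ν := by
    rw [Equiv.Perm.mul_apply, ← hν', hσ₂, Equiv.swap_apply_left]
  refine ⟨σ₂ * σ₁, q.src - p.src.permute (σ₂ * σ₁), ?_⟩
  have hperm : p.permute (σ₂ * σ₁) = ⟨p.src.permute (σ₂ * σ₁), q.μ, q.ν, q.hμν⟩ := by
    unfold Plaq.permute Plaq.mkOrdered
    rw [dif_pos (by rw [hπμ, hπν]; exact q.hμν)]
    exact Plaq.ext' rfl hπμ hπν
  rw [hperm]
  exact Plaq.ext' (by simp [Plaq.translate]) rfl rfl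

end Covariance

/-! ## §3 The law of the height-`j` averaged field under the Gibbs measure is permutation- and translation-invariant -/

section Law

variable {P : Params} {G : Type*} [GaugeGroup G] [MeasurableSpace G] [HaarData G] [RegularGaugeGroup G]

/-- **LAW OF `Ū^j` UNDER `π·`**: `∫ g(π·avg^j U) dGibbs(U) = ∫ g(avg^j U) dGibbs(U)` for EVERY `g` (`β ≥ 0`). [folklore] -/
theorem integral_gibbsMeasure_comp_iter_permute {β : ℝ} (hβ : 0 ≤ β) (ℰ : LoopAverage G) (π : Equiv.Perm (Fin P.d)) (j : ℕ)
    (g : GaugeField P j G → ℝ) :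
    ∫ U, g ((Averaging.iter (fun i => BlockAveraging.blockAvg (P := P) (j := i) ℰ) j U).permute π)
        ∂T4GenFunBounds.gibbsMeasure P β =
      ∫ U, g (Averaging.iter (fun i => BlockAveraging.blockAvg (P := P) (j := i) ℰ) j U)
        ∂T4GenFunBounds.gibbsMeasure (G := G) P β := by
  simp_rw [← iter_blockAvg_permute ℰ π j]
  exact integral_gibbsMeasure_comp_permute hβ π
    (fun U => g (Averaging.iter (fun i => BlockAveraging.blockAvg (P := P) (j := i) ℰ) j U))

/-- **LAW OF `Ū^j` UNDER `τ_b`**: `∫ g(τ_b avg^j U) dGibbs(U) = ∫ g(avg^j U) dGibbs(U)` for EVERY `g` (`β ≥ 0`). [folklore] -/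
theorem integral_gibbsMeasure_comp_iter_translate {β : ℝ} (hβ : 0 ≤ β) (ℰ : LoopAverage G) (j : ℕ) (b : Site P j)
    (g : GaugeField P j G → ℝ) :
    ∫ U, g ((Averaging.iter (fun i => BlockAveraging.blockAvg (P := P) (j := i) ℰ) j U).translate b)
        ∂T4GenFunBounds.gibbsMeasure P β =
      ∫ U, g (Averaging.iter (fun i => BlockAveraging.blockAvg (P := P) (j := i) ℰ) j U)
        ∂T4GenFunBounds.gibbsMeasure (G := G) P β := by
  simp_rw [← iter_blockAvg_translate ℰ j b]
  exact integral_gibbsMeasure_comp_translate hβ (Site.scaleTo j b)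
    (fun U => g (Averaging.iter (fun i => BlockAveraging.blockAvg (P := P) (j := i) ℰ) j U))

/-- Every-set form under `π·`: `Gibbs{U | π·(avg^j U) ∈ S} = Gibbs{U | avg^j U ∈ S}` for EVERY `S`. [folklore] -/
theorem gibbsMeasure_setOf_iter_permute {β : ℝ} (hβ : 0 ≤ β) (ℰ : LoopAverage G) (π : Equiv.Perm (Fin P.d)) (j : ℕ)
    (S : Set (GaugeField P j G)) :
    T4GenFunBounds.gibbsMeasure (G := G) P β
        {U | (Averaging.iter (fun i => BlockAveraging.blockAvg (P := P) (j := i) ℰ) j U).permute π ∈ S} =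
      T4GenFunBounds.gibbsMeasure (G := G) P β
        {U | Averaging.iter (fun i => BlockAveraging.blockAvg (P := P) (j := i) ℰ) j U ∈ S} := by
  have hset : {U : GaugeField P 0 G | (Averaging.iter (fun i => BlockAveraging.blockAvg (P := P) (j := i) ℰ) j U).permute π ∈ S} =
      GaugeField.permute π ⁻¹' {U | Averaging.iter (fun i => BlockAveraging.blockAvg (P := P) (j := i) ℰ) j U ∈ S} := by
    ext U
    simp only [Set.mem_setOf_eq, Set.mem_preimage, iter_blockAvg_permute]
  rw [hset, gibbsMeasure_preimage_permute hβ]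

/-- Every-set form under `τ_b`: `Gibbs{U | τ_b(avg^j U) ∈ S} = Gibbs{U | avg^j U ∈ S}` for EVERY `S`. [folklore] -/
theorem gibbsMeasure_setOf_iter_translate {β : ℝ} (hβ : 0 ≤ β) (ℰ : LoopAverage G) (j : ℕ) (b : Site P j)
    (S : Set (GaugeField P j G)) :
    T4GenFunBounds.gibbsMeasure (G := G) P β
        {U | (Averaging.iter (fun i => BlockAveraging.blockAvg (P := P) (j := i) ℰ) j U).translate b ∈ S} =
      T4GenFunBounds.gibbsMeasure (G := G) P β
        {U | Averaging.iter (fun i => BlockAveraging.blockAvg (P := P) (j := i) ℰ) j U ∈ S} := by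
  have hset : {U : GaugeField P 0 G | (Averaging.iter (fun i => BlockAveraging.blockAvg (P := P) (j := i) ℰ) j U).translate b ∈ S} =
      GaugeField.translate (Site.scaleTo j b) ⁻¹'
        {U | Averaging.iter (fun i => BlockAveraging.blockAvg (P := P) (j := i) ℰ) j U ∈ S} := by
    ext U
    simp only [Set.mem_setOf_eq, Set.mem_preimage, iter_blockAvg_translate]
  rw [hset, gibbsMeasure_preimage_translate hβ]

/-! ## §4 The law of `dist1(Ū^j(∂p))` does not depend on the plaquette `p` -/

/-- Under `π·`: `∫ φ(dist1(avg^j U (∂(π·p)))) dGibbs = ∫ φ(dist1(avg^j U (∂p))) dGibbs` for EVERY `φ`. [folklore] -/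
theorem integral_dist1_iterPlaq_permute {β : ℝ} (hβ : 0 ≤ β) (ℰ : LoopAverage G) (π : Equiv.Perm (Fin P.d)) {j : ℕ}
    (p : Plaq P j) (φ : ℝ → ℝ) :
    ∫ U, φ (dist1 (GaugeField.plaqHol (Averaging.iter (fun i => BlockAveraging.blockAvg (P := P) (j := i) ℰ) j U) (p.permute π)))
        ∂T4GenFunBounds.gibbsMeasure P β =
      ∫ U, φ (dist1 (GaugeField.plaqHol (Averaging.iter (fun i => BlockAveraging.blockAvg (P := P) (j := i) ℰ) j U) p))
        ∂T4GenFunBounds.gibbsMeasure (G := G) P β := by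
  simp_rw [← B12RegularClassInvariance263.dist1_plaqHol_permute π _ p]
  exact integral_gibbsMeasure_comp_iter_permute hβ ℰ π j (fun V => φ (dist1 (GaugeField.plaqHol V p)))

/-- Under `τ_b`: `∫ φ(dist1(avg^j U (∂(p + b)))) dGibbs = ∫ φ(dist1(avg^j U (∂p))) dGibbs` for EVERY `φ`. [folklore] -/
theorem integral_dist1_iterPlaq_translate {β : ℝ} (hβ : 0 ≤ β) (ℰ : LoopAverage G) {j : ℕ} (b : Site P j)
    (p : Plaq P j) (φ : ℝ → ℝ) :
    ∫ U, φ (dist1 (GaugeField.plaqHol (Averaging.iter (fun i => BlockAveraging.blockAvg (P := P) (j := i) ℰ) j U) (p.translate b)))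
        ∂T4GenFunBounds.gibbsMeasure P β =
      ∫ U, φ (dist1 (GaugeField.plaqHol (Averaging.iter (fun i => BlockAveraging.blockAvg (P := P) (j := i) ℰ) j U) p))
        ∂T4GenFunBounds.gibbsMeasure (G := G) P β := by
  simp_rw [← GaugeField.plaqHol_translate b _ p]
  exact integral_gibbsMeasure_comp_iter_translate hβ ℰ j b (fun V => φ (dist1 (GaugeField.plaqHol V p)))

/-- **ONE PLAQUETTE PER HEIGHT (integrands)**: for any two plaquettes `p q` of level `j` and EVERY `φ : ℝ → ℝ`,
`∫ φ(dist1(avg^j U (∂p))) dGibbs = ∫ φ(dist1(avg^j U (∂q))) dGibbs`. [folklore] -/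
theorem integral_dist1_iterPlaq_eq {β : ℝ} (hβ : 0 ≤ β) (ℰ : LoopAverage G) {j : ℕ} (p q : Plaq P j) (φ : ℝ → ℝ) :
    ∫ U, φ (dist1 (GaugeField.plaqHol (Averaging.iter (fun i => BlockAveraging.blockAvg (P := P) (j := i) ℰ) j U) p))
        ∂T4GenFunBounds.gibbsMeasure P β =
      ∫ U, φ (dist1 (GaugeField.plaqHol (Averaging.iter (fun i => BlockAveraging.blockAvg (P := P) (j := i) ℰ) j U) q))
        ∂T4GenFunBounds.gibbsMeasure (G := G) P β := by
  obtain ⟨π, b, rfl⟩ := exists_permute_translate_eq p q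
  rw [integral_dist1_iterPlaq_translate hβ ℰ b, integral_dist1_iterPlaq_permute hβ ℰ π p]

/-- Under `π·`, every-set form for `dist1(Ū^j(∂p))`: `Gibbs{Q(dist1(avg^j U(∂(π·p))))} = Gibbs{Q(dist1(avg^j U(∂p)))}`. [folklore] -/
theorem gibbsMeasure_setOf_dist1_iterPlaq_permute {β : ℝ} (hβ : 0 ≤ β) (ℰ : LoopAverage G) (π : Equiv.Perm (Fin P.d))
    {j : ℕ} (p : Plaq P j) (Q : ℝ → Prop) :
    T4GenFunBounds.gibbsMeasure (G := G) P β
        {U | Q (dist1 (GaugeField.plaqHol (Averaging.iter (fun i => BlockAveraging.blockAvg (P := P) (j := i) ℰ) j U) (p.permute π)))} =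
      T4GenFunBounds.gibbsMeasure (G := G) P β
        {U | Q (dist1 (GaugeField.plaqHol (Averaging.iter (fun i => BlockAveraging.blockAvg (P := P) (j := i) ℰ) j U) p))} := by
  have h := gibbsMeasure_setOf_iter_permute (G := G) hβ ℰ π j {V | Q (dist1 (GaugeField.plaqHol V p))}
  simp only [Set.mem_setOf_eq, B12RegularClassInvariance263.dist1_plaqHol_permute] at h
  exact h

/-- Under `τ_b`, every-set form for `dist1(Ū^j(∂p))`. [folklore] -/
theorem gibbsMeasure_setOf_dist1_iterPlaq_translate {β : ℝ} (hβ : 0 ≤ β) (ℰ : LoopAverage G) {j : ℕ} (b : Site P j)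
    (p : Plaq P j) (Q : ℝ → Prop) :
    T4GenFunBounds.gibbsMeasure (G := G) P β
        {U | Q (dist1 (GaugeField.plaqHol (Averaging.iter (fun i => BlockAveraging.blockAvg (P := P) (j := i) ℰ) j U) (p.translate b)))} =
      T4GenFunBounds.gibbsMeasure (G := G) P β
        {U | Q (dist1 (GaugeField.plaqHol (Averaging.iter (fun i => BlockAveraging.blockAvg (P := P) (j := i) ℰ) j U) p))} := by
  have h := gibbsMeasure_setOf_iter_translate (G := G) hβ ℰ j b {V | Q (dist1 (GaugeField.plaqHol V p))}
  simp only [Set.mem_setOf_eq, GaugeField.plaqHol_translate] at h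
  exact h

/-- **ONE PLAQUETTE PER HEIGHT (events)**: for any two plaquettes `p q` of level `j` and EVERY predicate `Q : ℝ → Prop`,
`Gibbs{U | Q(dist1(avg^j U(∂p)))} = Gibbs{U | Q(dist1(avg^j U(∂q)))}`. [folklore] -/
theorem gibbsMeasure_setOf_dist1_iterPlaq_eq {β : ℝ} (hβ : 0 ≤ β) (ℰ : LoopAverage G) {j : ℕ} (p q : Plaq P j)
    (Q : ℝ → Prop) :
    T4GenFunBounds.gibbsMeasure (G := G) P β
        {U | Q (dist1 (GaugeField.plaqHol (Averaging.iter (fun i => BlockAveraging.blockAvg (P := P) (j := i) ℰ) j U) p))} =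
      T4GenFunBounds.gibbsMeasure (G := G) P β
        {U | Q (dist1 (GaugeField.plaqHol (Averaging.iter (fun i => BlockAveraging.blockAvg (P := P) (j := i) ℰ) j U) q))} := by
  obtain ⟨π, b, rfl⟩ := exists_permute_translate_eq p q
  rw [gibbsMeasure_setOf_dist1_iterPlaq_translate hβ ℰ b, gibbsMeasure_setOf_dist1_iterPlaq_permute hβ ℰ π p]

/-- The same for real masses `Gibbs.real`. [folklore] -/
theorem gibbsMeasure_real_setOf_dist1_iterPlaq_eq {β : ℝ} (hβ : 0 ≤ β) (ℰ : LoopAverage G) {j : ℕ} (p q : Plaq P j)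
    (Q : ℝ → Prop) :
    (T4GenFunBounds.gibbsMeasure (G := G) P β).real
        {U | Q (dist1 (GaugeField.plaqHol (Averaging.iter (fun i => BlockAveraging.blockAvg (P := P) (j := i) ℰ) j U) p))} =
      (T4GenFunBounds.gibbsMeasure (G := G) P β).real
        {U | Q (dist1 (GaugeField.plaqHol (Averaging.iter (fun i => BlockAveraging.blockAvg (P := P) (j := i) ℰ) j U) q))} := by
  rw [measureReal_def, measureReal_def, gibbsMeasure_setOf_dist1_iterPlaq_eq hβ ℰ p q Q]

end Law

/-! ## §5 In the tokens of the R3 lane (`T3UnitScaleTilt.gibbsK`) and the four consumer-shaped reductions -/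

section T3

variable (F : T3Family) {G : Type*} [GaugeGroup G] [MeasurableSpace G] [HaarData G] [RegularGaugeGroup G]
  (ℰ : LoopAverage G) {γ : ℝ}

/-- **`gibbsK`: ONE PLAQUETTE PER HEIGHT (integrands)** — for `0 ≤ γ`, every `K j`, any two plaquettes `p q : Plaq (F.P K) j` and
EVERY `φ : ℝ → ℝ`: `∫ φ(dist1(Ū^j(∂p))) d gibbsK_K = ∫ φ(dist1(Ū^j(∂q))) d gibbsK_K`. [cite: Balaban1985UV3, (1)-(3) p.256] -/
theorem gibbsK_integral_dist1_iterPlaq_eq (hγ : 0 ≤ γ) (K : ℕ) {j : ℕ} (p q : Plaq (F.P K) j) (φ : ℝ → ℝ) :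
    ∫ U, φ (dist1 (GaugeField.plaqHol (Averaging.iter (fun i => BlockAveraging.blockAvg (P := F.P K) (j := i) ℰ) j U) p))
        ∂gibbsK F ℰ γ K =
      ∫ U, φ (dist1 (GaugeField.plaqHol (Averaging.iter (fun i => BlockAveraging.blockAvg (P := F.P K) (j := i) ℰ) j U) q))
        ∂gibbsK F ℰ γ K :=
  integral_dist1_iterPlaq_eq (F.scheme_β_nonneg ℰ hγ K) ℰ p q φ

/-- **`gibbsK`: ONE PLAQUETTE PER HEIGHT (events)** — `gibbsK_K.real{U | Q(dist1(Ū^j(∂p)))} = gibbsK_K.real{U | Q(dist1(Ū^j(∂q)))}`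
for EVERY predicate `Q`. [cite: Balaban1985UV3, (1)-(3) p.256] -/
theorem gibbsK_real_setOf_dist1_iterPlaq_eq (hγ : 0 ≤ γ) (K : ℕ) {j : ℕ} (p q : Plaq (F.P K) j) (Q : ℝ → Prop) :
    (gibbsK F ℰ γ K).real
        {U | Q (dist1 (GaugeField.plaqHol (Averaging.iter (fun i => BlockAveraging.blockAvg (P := F.P K) (j := i) ℰ) j U) p))} =
      (gibbsK F ℰ γ K).real
        {U | Q (dist1 (GaugeField.plaqHol (Averaging.iter (fun i => BlockAveraging.blockAvg (P := F.P K) (j := i) ℰ) j U) q))} :=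
  gibbsMeasure_real_setOf_dist1_iterPlaq_eq (F.scheme_β_nonneg ℰ hγ K) ℰ p q Q

/-- **REDUCTION 1 (first moment; the shape of stmt-QuantumFields-23083 / 23133 / 23134)**: a bound on `∫ dist1(Ū^j(∂q)) d gibbsK_K`
at ONE reference plaquette `q` holds at EVERY plaquette of that height. [cite: Balaban1985UV3, (1)-(3) p.256] -/
theorem integral_dist1_iterPlaq_le_of_ref (hγ : 0 ≤ γ) (K : ℕ) {j : ℕ} (q : Plaq (F.P K) j) {c : ℝ}
    (h : ∫ U, dist1 (GaugeField.plaqHol (Averaging.iter (fun i => BlockAveraging.blockAvg (P := F.P K) (j := i) ℰ) j U) q)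
      ∂gibbsK F ℰ γ K ≤ c) (p : Plaq (F.P K) j) :
    ∫ U, dist1 (GaugeField.plaqHol (Averaging.iter (fun i => BlockAveraging.blockAvg (P := F.P K) (j := i) ℰ) j U) p)
      ∂gibbsK F ℰ γ K ≤ c := by
  rw [gibbsK_integral_dist1_iterPlaq_eq F ℰ hγ K p q (fun t => t)]
  exact h

/-- **REDUCTION 2 (second moment; LINE 28's `shallowFluxSecondMomentL` shape)**: ONE reference plaquette ⇒ all. [cite: Balaban1985UV3, (1)-(3) p.256] -/
theorem integral_dist1_sq_iterPlaq_le_of_ref (hγ : 0 ≤ γ) (K : ℕ) {j : ℕ} (q : Plaq (F.P K) j) {c : ℝ}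
    (h : ∫ U, (dist1 (GaugeField.plaqHol (Averaging.iter (fun i => BlockAveraging.blockAvg (P := F.P K) (j := i) ℰ) j U) q)) ^ 2
      ∂gibbsK F ℰ γ K ≤ c) (p : Plaq (F.P K) j) :
    ∫ U, (dist1 (GaugeField.plaqHol (Averaging.iter (fun i => BlockAveraging.blockAvg (P := F.P K) (j := i) ℰ) j U) p)) ^ 2
      ∂gibbsK F ℰ γ K ≤ c := by
  rw [gibbsK_integral_dist1_iterPlaq_eq F ℰ hγ K p q (fun t => t ^ 2)]
  exact h

/-- **REDUCTION 3 (quantile; (Q) `stub_quantileDeviation` shape, stmt-23133)**: ONE reference plaquette ⇒ all. [cite: Balaban1985UV3, (1)-(3) p.256] -/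
theorem le_gibbsK_real_dist1_iterPlaq_le_of_ref (hγ : 0 ≤ γ) (K : ℕ) {j : ℕ} (q : Plaq (F.P K) j) {c t : ℝ}
    (h : c ≤ (gibbsK F ℰ γ K).real
      {U | dist1 (GaugeField.plaqHol (Averaging.iter (fun i => BlockAveraging.blockAvg (P := F.P K) (j := i) ℰ) j U) q) ≤ t})
    (p : Plaq (F.P K) j) :
    c ≤ (gibbsK F ℰ γ K).real
      {U | dist1 (GaugeField.plaqHol (Averaging.iter (fun i => BlockAveraging.blockAvg (P := F.P K) (j := i) ℰ) j U) p) ≤ t} := by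
  rw [gibbsK_real_setOf_dist1_iterPlaq_eq F ℰ hγ K p q (fun s => s ≤ t)]
  exact h

/-- **REDUCTION 4 (large-field tail `{t ≤ dist1}`; the K2 per-plaquette shape)**: ONE reference plaquette ⇒ all. [cite: Balaban1985UV3, (1)-(3) p.256] -/
theorem gibbsK_real_le_dist1_iterPlaq_le_of_ref (hγ : 0 ≤ γ) (K : ℕ) {j : ℕ} (q : Plaq (F.P K) j) {c t : ℝ}
    (h : (gibbsK F ℰ γ K).real
      {U | t ≤ dist1 (GaugeField.plaqHol (Averaging.iter (fun i => BlockAveraging.blockAvg (P := F.P K) (j := i) ℰ) j U) q)} ≤ c)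
    (p : Plaq (F.P K) j) :
    (gibbsK F ℰ γ K).real
      {U | t ≤ dist1 (GaugeField.plaqHol (Averaging.iter (fun i => BlockAveraging.blockAvg (P := F.P K) (j := i) ℰ) j U) p)} ≤ c := by
  rw [gibbsK_real_setOf_dist1_iterPlaq_eq F ℰ hγ K p q (fun s => t ≤ s)]
  exact h

/-- **REDUCTION 4′ (the negated strict form `¬ dist1 < t`, as `histGood` negates it — LINE 31 S1's wording)**. [cite: Balaban1985UV3, (7) p.257] -/
theorem gibbsK_real_not_dist1_iterPlaq_lt_le_of_ref (hγ : 0 ≤ γ) (K : ℕ) {j : ℕ} (q : Plaq (F.P K) j) {c t : ℝ}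
    (h : (gibbsK F ℰ γ K).real
      {U | ¬ dist1 (GaugeField.plaqHol (Averaging.iter (fun i => BlockAveraging.blockAvg (P := F.P K) (j := i) ℰ) j U) q) < t} ≤ c)
    (p : Plaq (F.P K) j) :
    (gibbsK F ℰ γ K).real
      {U | ¬ dist1 (GaugeField.plaqHol (Averaging.iter (fun i => BlockAveraging.blockAvg (P := F.P K) (j := i) ℰ) j U) p) < t} ≤ c := by
  rw [gibbsK_real_setOf_dist1_iterPlaq_eq F ℰ hγ K p q (fun s => ¬ s < t)]
  exact h
end T3

end Summit.QuantumFields.YangMills.Theorems.UnitScaleGibbsAveragedPlaquetteLawSymmetry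

end
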